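import Summits.QuantumFields.YangMills.Theorems.UnitScaleTiltHistoryTailOfPackagePinnedLf
import Summits.QuantumFields.YangMills.Theorems.UV3PinnedStepOrganOfGrowingMassEnvelope
import HarnessLib

/-!
# R3 (cell `ym3-torus`, YM₃ on T³ — a ladder RUNG, NOT d = 4, NOT infinite volume, NOT a mass gap, NOT the Clay problem) —
# **THE PROBABILITY DOOR OF THE PinnedStability LINE WITH A SLACK EXPONENTIAL IN THE RUN LENGTH ON THE ENVELOPE SIDE**
# (`ρ_K ≤ e^{A₂K}·e^{Cl}·Z_K` a.e. ⟹ the K-19′ letter `hP′`, power `A + ⌈A₂m∕log L⌉₊`)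

LEAD seat `ym-ust-19936-w1` g11 on crux `stmt-QuantumFields-19936` (`--supports`, helper; ONE theorem, 0 `def`, 0 `sorry`).  Companion of
✓`UnitScaleTiltHistoryTailOfPackagePartialIterates.pinnedHeightTail_of_lin'` (slack `K + 1`): the run-linear-exponent kinematic letters now on the table —
w5 g18's hJ♭ ∕ hTop♭ (✓`UV3PinnedStepOrganOfGrowingMassEnvelope`, `…OfGrowingPartialIterates`: «top push-forward density `≤ e^{c₀ + c₁K}`», one non-decaying
defect per RG level tolerated — the `θ = L⁻³` borderline of the laundering) — deliver on the U side a unit envelope `ρ_K ≤ e^{A₂K}·e^{Cl}·Z_K`; this door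
absorbs `e^{A₂K} ≤ e^{A₂m}·β_{K−j}^{⌈A₂m∕log L⌉₊}` at the constrained heights (w5's ✓`exp_mul_le_exp_mul_beta_pow`) and returns `hP′` VERBATIM, so the
composition into the LEAD socket ✓p748552 `historyTailL_of_pinnedHeightTail_freeRate` is again one `exact`.  The U♭ letters and the guarded crux face over
hTop♭ are w5 g18's to type over this door BY NAME (LEAD dispatch «w5: GO U♭»).

HONEST SCOPE.  A door (pure bookkeeping: Gibbs probability = restricted integral ∕ `Z_K`, `integral_mono_ae`, one arithmetic absorption); it proves nothing of
the organs, of `stub_pinnedStep`∕`stub_unitEnvelope`, of `HistoryTailL` (19936), the rung, d = 4, a mass gap or Clay.  YM₃ on T³ is rung R3, not the Clay problem.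

References: T. Bałaban, Commun. Math. Phys. **102** (1985) 255–275 [Balaban1985UV3] ((2) p. 256, (5)–(7) pp. 256–257, (41) p. 266, (47) p. 267).
-/

set_option autoImplicit false

noncomputable section

namespace Summit.QuantumFields.YangMills.Theorems.UnitScaleTiltPinnedHeightTailDoorExpSlack

open scoped BigOperators ENNReal
open MeasureTheory
open Literature.MathematicalPhysics.QuantumFieldTheory.Balaban1983to89
open Literature.MathematicalPhysics.QuantumFieldTheory.Balaban1983to89.T3ContinuumYM3Torus
open Literature.MathematicalPhysics.QuantumFieldTheory.Balaban1983to89.T3UnitScaleTilt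
open Literature.MathematicalPhysics.QuantumFieldTheory.Balaban1983to89.T3UnitLawDensityEML
open Literature.MathematicalPhysics.QuantumFieldTheory.Balaban1983to89.T3RestrictedUnitDensity
open Literature.MathematicalPhysics.QuantumFieldTheory.Balaban1983to89.T3CruxEstimates
open Literature.MathematicalPhysics.QuantumFieldTheory.Balaban1983to89.T3AlphaInputsAC
open Literature.MathematicalPhysics.QuantumFieldTheory.Balaban1983to89.Missing (partitionFn partitionFn_pos' isProbabilityMeasure_fieldMeasure)
open Literature.MathematicalPhysics.QuantumFieldTheory.Balaban1985CMP102
open Literature.MathematicalPhysics.QuantumFieldTheory.Balaban1985CMP102.Setting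
open Summit.QuantumFields.Balaban3D.Carriers
open Summit.QuantumFields.Balaban3D.Proofs.Primitives
open Summit.QuantumFields.YangMills.Theorems.UV3PinnedStepProfileReduction (measurableSet_pinEvent)
open Summit.QuantumFields.YangMills.Theorems.UV3PinnedStepOrganOfGrowingMassEnvelope (exp_mul_le_exp_mul_beta_pow)

/-! ## The door with a slack `e^{A₂K}` -/

/-- ★★ **THE PINNED HEIGHT TAIL `hP′` (K-19′'s hypothesis, VERBATIM) FROM THE S-STEP TEXT (v3) AND A UNIT ENVELOPE WITH A SLACK `e^{A₂·K}`.**  As ✓`UnitScaleTiltHistoryTailOfPackagePartialIterates.pinnedHeightTail_of_lin'`, but the envelope row reads `ρ_K ≤ e^{A₂K}·e^{Cl}·Z_K` a.e. with `A₂ ≥ 0` chosen per `(F, γ)`; per `(K, j, a)`: `Gibbs_K(E) ≤ e^{A₂K}·e^{Cl+Cu}·β^A·e^{−cp²}`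
(S-step at `M := e^{A₂K}·e^{Cl}·Z_K`), and at the constrained heights `e^{A₂K} ≤ e^{A₂m}·β_{K−j}^{⌈A₂m∕log L⌉₊}` (w5 g18's ✓`UV3PinnedStepOrganOfGrowingMassEnvelope.exp_mul_le_exp_mul_beta_pow`;
`γ ≤ γ₁ ≤ 1`), so the letter holds with `C := e^{A₂m}·e^{Cu+Cl}` and the power `A + ⌈A₂m∕log L⌉₊`.  This is the door the run-linear-exponent kinematic letters need on the U side
(hTop♭ «top push-forward density `≤ e^{c₀+c₁K}`»: one non-decaying defect per RG level is tolerated — the `θ = L⁻³` borderline of the laundering). [cite: Balaban1985UV3, (2) p.256, (5)-(7) pp.256-257] -/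
theorem pinnedHeightTail_of_exp'
    (hStep : ∀ (L : ℕ), ∃ (b₁' p₁' : ℝ), ∀ (b₀ p₀ : ℝ), b₁' ≤ b₀ → p₁' ≤ p₀ → 0 < b₀ → 2 < p₀ → ∀ (m : ℕ), 0 < m →
      ∃ γ₁ : ℝ, 0 < γ₁ ∧ γ₁ ≤ 1 ∧ ∀ (F : T3Family) (γ : ℝ), F.L = L → 0 < γ → γ ≤ γ₁ →
        ∃ (b p Cu c : ℝ) (A : ℕ), 0 < b ∧ 1 ≤ p ∧ 0 < c ∧
          ∀ (K j : ℕ), 1 ≤ j → j + 2 ≤ K → j + (K - 1) / m ≤ K → ∀ (a : Plaq (F.P K) j) (M : ℝ),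
          (∀ᵐ V ∂(fieldMeasure (F.P K) K (Matrix.specialUnitaryGroup (Fin 2) ℂ)), emlDensity F γ K K V ≤ M) →
          ∀ᵐ V ∂(fieldMeasure (F.P K) K (Matrix.specialUnitaryGroup (Fin 2) ℂ)),
            resDensity F γ K
              ({U : GaugeField (F.P K) 0 (Matrix.specialUnitaryGroup (Fin 2) ℂ) |
                  θBal F.L γ b₀ p₀ (K - j) ≤ GaugeGroup.dist1 (GaugeField.plaqHol
                    (Averaging.iter (fun i' => BlockAveraging.blockAvg (P := F.P K) (j := i') ℰp) j U) a)} ∩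
                {U : GaugeField (F.P K) 0 (Matrix.specialUnitaryGroup (Fin 2) ℂ) | ∀ i, i < j →
                  PlaqSmall (θBal F.L γ b₀ p₀ (K - i))
                    (Averaging.iter (fun i' => BlockAveraging.blockAvg (P := F.P K) (j := i') ℰp) i U)})
              K V ≤
            M * Real.exp Cu *
              ((F.scheme ℰp γ).β (K - j) ^ A * Real.exp (-(c * B10.pFun b p (Real.sqrt (γ * ((F.L : ℝ)⁻¹) ^ (K - j))) ^ 2))))
    (hLowExp : ∀ (L : ℕ), ∃ γ₁ : ℝ, 0 < γ₁ ∧ ∀ (F : T3Family) (γ : ℝ), F.L = L → 0 < γ → γ ≤ γ₁ →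
      ∃ (Cl A₂ : ℝ), 0 ≤ A₂ ∧ ∀ K : ℕ, ∀ᵐ V ∂(fieldMeasure (F.P K) K (Matrix.specialUnitaryGroup (Fin 2) ℂ)),
        emlDensity F γ K K V ≤
          Real.exp (A₂ * K) * (Real.exp Cl * partitionFn (G := Matrix.specialUnitaryGroup (Fin 2) ℂ) (F.P K) ((F.scheme ℰp γ).β K))) :
    ∀ (L : ℕ), ∃ (b₁' p₁' : ℝ), ∀ (b₀ p₀ : ℝ), b₁' ≤ b₀ → p₁' ≤ p₀ → 0 < b₀ → 2 < p₀ → ∀ (m : ℕ), 0 < m →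
      ∃ γ₁ : ℝ, 0 < γ₁ ∧ γ₁ ≤ 1 ∧ ∀ (F : T3Family) (γ : ℝ), F.L = L → 0 < γ → γ ≤ γ₁ →
        ∃ (b p C c : ℝ) (A : ℕ), 0 < b ∧ 1 ≤ p ∧ 0 ≤ C ∧ 0 < c ∧
          ∀ (K j : ℕ), 1 ≤ j → j + 2 ≤ K → j + (K - 1) / m ≤ K → ∀ a : Plaq (F.P K) j,
          (gibbsK F ℰp γ K).real
              ({U : GaugeField (F.P K) 0 (Matrix.specialUnitaryGroup (Fin 2) ℂ) |
                  θBal F.L γ b₀ p₀ (K - j) ≤ GaugeGroup.dist1 (GaugeField.plaqHol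
                    (Averaging.iter (fun i' => BlockAveraging.blockAvg (P := F.P K) (j := i') ℰp) j U) a)} ∩
                {U : GaugeField (F.P K) 0 (Matrix.specialUnitaryGroup (Fin 2) ℂ) | ∀ i, i < j →
                  PlaqSmall (θBal F.L γ b₀ p₀ (K - i))
                    (Averaging.iter (fun i' => BlockAveraging.blockAvg (P := F.P K) (j := i') ℰp) i U)}) ≤
            C * (F.scheme ℰp γ).β (K - j) ^ A *
              Real.exp (-(c * B10.pFun b p (Real.sqrt (γ * ((F.L : ℝ)⁻¹) ^ (K - j))) ^ 2)) := by
  intro L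
  obtain ⟨b₁', p₁', HS⟩ := hStep L
  obtain ⟨γL, hγL, HL⟩ := hLowExp L
  refine ⟨b₁', p₁', fun b₀ p₀ hb hp hb₀ hp₀ m hm => ?_⟩
  obtain ⟨γ₁, hγ₁, hγ₁1, HF⟩ := HS b₀ p₀ hb hp hb₀ hp₀ m hm
  refine ⟨min γ₁ γL, lt_min hγ₁ hγL, (min_le_left _ _).trans hγ₁1, fun F γ hFL hγ hγle => ?_⟩
  obtain ⟨b, p, Cu, c, A, hb0, hp1, hc, hstep⟩ := HF F γ hFL hγ (hγle.trans (min_le_left _ _))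
  obtain ⟨Cl, A₂, hA₂, hlow⟩ := HL F γ hFL hγ (hγle.trans (min_le_right _ _))
  have hγle1 : γ ≤ 1 := (hγle.trans (min_le_left _ _)).trans hγ₁1
  refine ⟨b, p, Real.exp (A₂ * m) * Real.exp (Cu + Cl), c, A + ⌈A₂ * m / Real.log F.L⌉₊, hb0, hp1, by positivity, hc,
    fun K j hj1 hjK hjm a => ?_⟩
  -- names
  set E : Set (GaugeField (F.P K) 0 (Matrix.specialUnitaryGroup (Fin 2) ℂ)) :=
    {U : GaugeField (F.P K) 0 (Matrix.specialUnitaryGroup (Fin 2) ℂ) |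
        θBal F.L γ b₀ p₀ (K - j) ≤ GaugeGroup.dist1 (GaugeField.plaqHol
          (Averaging.iter (fun i' => BlockAveraging.blockAvg (P := F.P K) (j := i') ℰp) j U) a)} ∩
      {U : GaugeField (F.P K) 0 (Matrix.specialUnitaryGroup (Fin 2) ℂ) | ∀ i, i < j →
        PlaqSmall (θBal F.L γ b₀ p₀ (K - i))
          (Averaging.iter (fun i' => BlockAveraging.blockAvg (P := F.P K) (j := i') ℰp) i U)} with hEdef
  set R : ℝ := Real.exp (-(c * B10.pFun b p (Real.sqrt (γ * ((F.L : ℝ)⁻¹) ^ (K - j))) ^ 2)) with hRdef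
  set w : ℝ := (F.scheme ℰp γ).β (K - j) ^ A * R with hwdef
  set Z : ℝ := partitionFn (G := Matrix.specialUnitaryGroup (Fin 2) ℂ) (F.P K) ((F.scheme ℰp γ).β K) with hZdef
  set A' : ℕ := ⌈A₂ * m / Real.log F.L⌉₊ with hA'def
  have hγ0 : 0 ≤ γ := hγ.le
  have hβ0 : 0 ≤ (F.scheme ℰp γ).β (K - j) := F.scheme_β_nonneg ℰp hγ0 (K - j)
  have hR0 : 0 ≤ R := by rw [hRdef]; exact (Real.exp_pos _).le
  have hw : 0 ≤ w := mul_nonneg (pow_nonneg hβ0 A) hR0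
  have hZ : 0 < Z := partitionFn_pos' _ (F.scheme_β_nonneg ℰp hγ0 K)
  -- the constrained heights absorb `e^{A₂K}`
  have hKβ : Real.exp (A₂ * K) ≤ Real.exp (A₂ * m) * (F.scheme ℰp γ).β (K - j) ^ A' :=
    exp_mul_le_exp_mul_beta_pow F hγ hγle1 hm hA₂ hjm
  -- measurability of the event
  have hE : MeasurableSet E := measurableSet_pinEvent F γ K b₀ p₀ (by omega) a
  -- (2)/(6): the Gibbs probability of `E` is the integral of the final restricted density over `Z_K`
  have hrepr : (gibbsK F ℰp γ K).real E =
      (∫ V, resDensity F γ K E K V ∂fieldMeasure (F.P K) K (Matrix.specialUnitaryGroup (Fin 2) ℂ)) / Z := by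
    have e := real_gibbsK_iter_mem F hγ0 K 0 (Nat.zero_le _) hE
    have e' : (gibbsK F ℰp γ K).real E =
        (∫ V in E, emlDensity F γ K 0 V ∂fieldMeasure (F.P K) 0 (Matrix.specialUnitaryGroup (Fin 2) ℂ)) / Z := e
    rw [e', ← integral_indicator hE]
    congr 1
    have h1 := integral_resDensity_mul F K hE hγ0 (k := K) (Nat.le_add_left K F.m) (fun _ => (1 : ℝ)) measurable_const
      ⟨1, fun _ => by simp⟩
    simp only [mul_one] at h1
    rw [h1]
    rfl
  -- a.e.: ρ^E_K ≤ (e^{A₂K}·e^{Cl}·Z_K)·e^{Cu}·w — S-step fed with the slack envelope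
  have hae : ∀ᵐ V ∂(fieldMeasure (F.P K) K (Matrix.specialUnitaryGroup (Fin 2) ℂ)),
      resDensity F γ K E K V ≤ (Real.exp (A₂ * K) * (Real.exp Cl * Z)) * Real.exp Cu * w :=
    hstep K j hj1 hjK hjm a (Real.exp (A₂ * K) * (Real.exp Cl * Z)) (hlow K)
  -- integrate over the last fibre (product Haar is a probability measure)
  haveI : IsProbabilityMeasure (fieldMeasure (F.P K) K (Matrix.specialUnitaryGroup (Fin 2) ℂ)) :=
    isProbabilityMeasure_fieldMeasure _ _
  have hnum : (∫ V, resDensity F γ K E K V ∂fieldMeasure (F.P K) K (Matrix.specialUnitaryGroup (Fin 2) ℂ)) ≤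
      (Real.exp (A₂ * K) * (Real.exp Cl * Z)) * Real.exp Cu * w := by
    have hmono := integral_mono_ae (integrable_resDensity F K hE hγ0 (k := K) (Nat.le_add_left K F.m))
      (integrable_const ((Real.exp (A₂ * K) * (Real.exp Cl * Z)) * Real.exp Cu * w)) hae
    simpa [integral_const, smul_eq_mul] using hmono
  -- assemble
  have hX0 : 0 ≤ Real.exp Cl * Z * Real.exp Cu * w := by positivity
  rw [hrepr, div_le_iff₀ hZ]
  calc (∫ V, resDensity F γ K E K V ∂fieldMeasure (F.P K) K (Matrix.specialUnitaryGroup (Fin 2) ℂ))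
      ≤ (Real.exp (A₂ * K) * (Real.exp Cl * Z)) * Real.exp Cu * w := hnum
    _ = Real.exp (A₂ * K) * (Real.exp Cl * Z * Real.exp Cu * w) := by ring
    _ ≤ Real.exp (A₂ * m) * (F.scheme ℰp γ).β (K - j) ^ A' * (Real.exp Cl * Z * Real.exp Cu * w) :=
        mul_le_mul_of_nonneg_right hKβ hX0
    _ = Real.exp (A₂ * m) * Real.exp (Cu + Cl) * (F.scheme ℰp γ).β (K - j) ^ (A + A') * R * Z := by
        rw [Real.exp_add, hwdef, pow_add]; ring

end Summit.QuantumFields.YangMills.Theorems.UnitScaleTiltPinnedHeightTailDoorExpSlack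

end
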